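import Summits.Ventures.PercRepro.PuncturedLYMCoHypSeq

/-!
# PercRepro — ONE CO-HYPERPLANE OF ANY SIZE, PART 2b: THE SEQUENCES OF PART 1 FROM THE EXACT SOLUTION (p10, gen 33)

With `k = #P/C(n, j+1)` (`coK`), `xv c = (k/(j+1))·(1 − ξ_c)` (`coXv`) and `yv c = (k/(j+1))·(1 + η_c)` (`coYv`):
`coK_delta` (`k·(n − j + Δ) = j + 1`, from `(j+1)·C(n, j+1) = (n − j)·C(n, j)`), then `coSeq_nonneg`, `coSeq_row`
(the row identity `(m − c)·yv c + (n − j − m + c)·xv c = 1`), `coSeq_col0` (`(j + 1)·xv 0 = k`), `coSeq_col`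
(`c'·yv (c' − 1) + (j + 1 − c')·xv c' = k`, from the recursion `coXi_succ`) and `coSeq_top` (`m·yv (m − 1) = k`, from
`coTop`) — exactly the hypotheses of `puncturedNMP_upLevel_of_seq`.  Nothing here asserts (SP).
-/

namespace PercRepro.PuncturedLYM

open Finset

/-! ### The sequences of part 1 -/

/-- `k = #P / C(n, j + 1)`. -/
def coK (n j m : ℕ) : ℚ := coP n j m / (n.choose (j + 1) : ℕ)

/-- `xv c = (k/(j+1))·(1 − ξ_c)`. -/
def coXv (n j m c : ℕ) : ℚ := coK n j m / ((j : ℚ) + 1) * (1 - coXi n j m c)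

/-- `yv c = (k/(j+1))·(1 + η_c)`. -/
def coYv (n j m c : ℕ) : ℚ := coK n j m / ((j : ℚ) + 1) * (1 + coEta n j m c)

/-- `k > 0`. -/
theorem coK_pos {n j m : ℕ} (hm : 1 ≤ m) (hmj : m ≤ j) (hn : 2 * j + 1 ≤ n) : 0 < coK n j m := by
  unfold coK
  apply div_pos (coP_pos hm hmj hn)
  exact_mod_cast Nat.choose_pos (by omega)

/-- `k·(n − j + Δ) = j + 1`: `(j+1)·C(n, j+1) = (n − j)·C(n, j)`. -/
theorem coK_delta {n j m : ℕ} (hm : 1 ≤ m) (hmj : m ≤ j) (hn : 2 * j + 1 ≤ n) :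
    coK n j m * (((n - j : ℕ) : ℚ) + coDelta n j m) = (j : ℚ) + 1 := by
  have hP := coP_pos hm hmj hn
  have hY : (0 : ℚ) < (n.choose (j + 1) : ℕ) := by exact_mod_cast Nat.choose_pos (by omega)
  have hch := Nat.choose_succ_right_eq n j
  have hchq : ((n.choose (j + 1) : ℕ) : ℚ) * ((j : ℚ) + 1) = ((n.choose j : ℕ) : ℚ) * ((n - j : ℕ) : ℚ) := by
    have : ((n.choose (j + 1) * (j + 1) : ℕ) : ℚ) = ((n.choose j * (n - j) : ℕ) : ℚ) := by rw [hch]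
    push_cast at this
    linarith
  unfold coK coDelta
  have hPdef : coP n j m = (n.choose j : ℚ) - ((n - m).choose (j - m) : ℕ) := rfl
  field_simp
  rw [hPdef]
  linear_combination (-1 : ℚ) * hchq

/-- The sequences are nonnegative for `c < m`. -/
theorem coSeq_nonneg {n j m c : ℕ} (hm : 1 ≤ m) (hmj : m ≤ j) (hn : 2 * j + 1 ≤ n) (hc : c < m) :
    0 ≤ coXv n j m c ∧ 0 ≤ coYv n j m c := by
  have hk := coK_pos hm hmj hn
  have hj : (0 : ℚ) < (j : ℚ) + 1 := by positivity
  constructor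
  · unfold coXv
    apply mul_nonneg (div_nonneg hk.le hj.le)
    linarith [coXi_le_one hm hmj hn hc.le]
  · unfold coYv
    apply mul_nonneg (div_nonneg hk.le hj.le)
    linarith [coEta_nonneg (c := c) hm hmj hn]

/-- The row identity `(m − c)·yv c + (n − j − m + c)·xv c = 1` for `c < m`. -/
theorem coSeq_row {n j m c : ℕ} (hm : 1 ≤ m) (hmj : m ≤ j) (hn : 2 * j + 1 ≤ n) (hc : c < m) :
    ((m : ℚ) - c) * coYv n j m c + ((n : ℚ) - j - m + c) * coXv n j m c = 1 := by
  have hkd := coK_delta hm hmj hn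
  have hmc : (0 : ℚ) < ((m - c : ℕ) : ℚ) := by
    have : 1 ≤ m - c := by omega
    exact_mod_cast this
  have hj : (0 : ℚ) < (j : ℚ) + 1 := by positivity
  have e1 : ((m : ℚ) - c) = ((m - c : ℕ) : ℚ) := by rw [Nat.cast_sub hc.le]
  have e2 : ((n : ℚ) - j - m + c) = ((n - j - m + c : ℕ) : ℚ) := by
    rw [Nat.cast_add, Nat.cast_sub (by omega), Nat.cast_sub (by omega)]
  have e3 : ((n - j : ℕ) : ℚ) = ((n - j - m + c : ℕ) : ℚ) + ((m - c : ℕ) : ℚ) := by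
    rw [← Nat.cast_add]
    congr 1
    omega
  -- `(m − c)·η_c = (n − j − m + c)·ξ_c + Δ`
  have hη : ((m - c : ℕ) : ℚ) * coEta n j m c = ((n - j - m + c : ℕ) : ℚ) * coXi n j m c + coDelta n j m := by
    unfold coEta
    field_simp
  unfold coYv coXv
  rw [e1, e2]
  rw [e3] at hkd
  have : ((m - c : ℕ) : ℚ) * (coK n j m / ((j : ℚ) + 1) * (1 + coEta n j m c)) +
      ((n - j - m + c : ℕ) : ℚ) * (coK n j m / ((j : ℚ) + 1) * (1 - coXi n j m c)) =
      coK n j m / ((j : ℚ) + 1) * (((n - j - m + c : ℕ) : ℚ) + ((m - c : ℕ) : ℚ) +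
        (((m - c : ℕ) : ℚ) * coEta n j m c - ((n - j - m + c : ℕ) : ℚ) * coXi n j m c)) := by ring
  rw [this, hη]
  have : ((n - j - m + c : ℕ) : ℚ) + ((m - c : ℕ) : ℚ) +
      (((n - j - m + c : ℕ) : ℚ) * coXi n j m c + coDelta n j m - ((n - j - m + c : ℕ) : ℚ) * coXi n j m c) =
      ((n - j - m + c : ℕ) : ℚ) + ((m - c : ℕ) : ℚ) + coDelta n j m := by ring
  rw [this]
  field_simp
  linear_combination hkd

/-- The column identity at `c' = 0`: `(j + 1)·xv 0 = k`. -/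
theorem coSeq_col0 (n j m : ℕ) : ((j : ℚ) + 1) * coXv n j m 0 = coK n j m := by
  unfold coXv
  rw [coXi_zero, sub_zero, mul_one]
  field_simp

/-- The column identity `c'·yv (c' − 1) + (j + 1 − c')·xv c' = k` for `1 ≤ c' < m`. -/
theorem coSeq_col {n j m c' : ℕ} (hm : 1 ≤ m) (hmj : m ≤ j) (hn : 2 * j + 1 ≤ n) (hc1 : 1 ≤ c') (hc : c' < m) :
    (c' : ℚ) * coYv n j m (c' - 1) + ((j : ℚ) + 1 - c') * coXv n j m c' = coK n j m := by
  obtain ⟨c, rfl⟩ : ∃ c, c' = c + 1 := ⟨c' - 1, by omega⟩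
  rw [Nat.add_sub_cancel]
  have hrec := coXi_succ (n := n) (j := j) (m := m) (c := c) hm hmj hn (by omega)
  have hmc : (0 : ℚ) < ((m - c : ℕ) : ℚ) := by
    have : 1 ≤ m - c := by omega
    exact_mod_cast this
  have hjc : (0 : ℚ) < ((j - c : ℕ) : ℚ) := by
    have : 1 ≤ j - c := by omega
    exact_mod_cast this
  have hj : (0 : ℚ) < (j : ℚ) + 1 := by positivity
  -- `(j − c)·ξ_{c+1} = (c + 1)·η_c`
  have hstep : ((j - c : ℕ) : ℚ) * coXi n j m (c + 1) = ((c : ℚ) + 1) * coEta n j m c := by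
    rw [hrec]
    unfold coEta
    field_simp
  have e1 : ((j : ℚ) + 1 - ((c + 1 : ℕ) : ℚ)) = ((j - c : ℕ) : ℚ) := by
    rw [Nat.cast_sub (by omega)]
    push_cast
    ring
  rw [e1]
  unfold coYv coXv
  push_cast
  have : ((c : ℚ) + 1) * (coK n j m / ((j : ℚ) + 1) * (1 + coEta n j m c)) +
      ((j - c : ℕ) : ℚ) * (coK n j m / ((j : ℚ) + 1) * (1 - coXi n j m (c + 1))) =
      coK n j m / ((j : ℚ) + 1) * ((((c : ℚ) + 1) + ((j - c : ℕ) : ℚ)) +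
        (((c : ℚ) + 1) * coEta n j m c - ((j - c : ℕ) : ℚ) * coXi n j m (c + 1))) := by ring
  rw [this, hstep]
  have e2 : ((c : ℚ) + 1) + ((j - c : ℕ) : ℚ) = (j : ℚ) + 1 := by
    rw [Nat.cast_sub (by omega)]
    ring
  rw [e2]
  field_simp
  ring

/-- The top column identity `m·yv (m − 1) = k`. -/
theorem coSeq_top {n j m : ℕ} (hm : 1 ≤ m) (hmj : m ≤ j) (hn : 2 * j + 1 ≤ n) :
    (m : ℚ) * coYv n j m (m - 1) = coK n j m := by
  have htop := coTop hm hmj hn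
  have hmq : (0 : ℚ) < (m : ℚ) := by exact_mod_cast hm
  have hj : (0 : ℚ) < (j : ℚ) + 1 := by positivity
  -- `η_{m−1} = (n − j − 1)·ξ_{m−1} + Δ`
  have hη : coEta n j m (m - 1) = ((n - j - 1 : ℕ) : ℚ) * coXi n j m (m - 1) + coDelta n j m := by
    unfold coEta
    have e1 : n - j - m + (m - 1) = n - j - 1 := by omega
    have e2 : m - (m - 1) = 1 := by omega
    rw [e1, e2]
    simp
  unfold coYv
  rw [hη, htop]
  have e3 : ((j + 1 - m : ℕ) : ℚ) = (j : ℚ) + 1 - m := by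
    rw [Nat.cast_sub (by omega)]
    push_cast
    ring
  rw [e3]
  field_simp
  ring

end PercRepro.PuncturedLYM
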